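import Summits.QuantumFields.YangMills.Theorems.BalabanUVNodesN15CovariantLandauFlatRowsAllKing
import HarnessLib

/-!
# Route «BalabanUVNodes», node N15 = NE2, road (c) — THE FLAT KERNEL ROWS AT **ZERO EXTRA SCALES** (`n = 0`: the fine run IS the coarse run relabelled, King's pairing is that relabelling,
# every two-grid η-defect VANISHES) AND THE TWELVE-ROW PACKAGE FOR EVERY `n ≥ 0` — the glued family's index `SfIdx` carries no lower bound on its extra scales `r`, so the node edition
# 234′ of dag-n15-c's (G3) road will ask the flat rows at `r = 0` too (dag-n15-a g34, (Ξ-5))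

Cell `pub-ymgap`, seat `pub-ymgap-dag-n15-a` (generation g34; KNIT-BY-NAME lane; HUMAN RULING D-0062; chair R424 venue).  `bears_on: R4∕N15 · K3⁸ SpineGivenEndpointR13SepCoPHV
(stmt-QuantumFields-27366)`; filed `--supports stmt-QuantumFields-27366 --as helper` — COUNT-NEUTRAL.  Theorems only; 0 `sorry`.  Imports BY NAME (Ξ-4) `…CovariantLandauFlatRowsAllKing`
(`flatRowsAll_king`; through it 220 `flatKernelRows_king`, (Ξ-3) `flatKernelRow_gradBack_king`, n15-c∕237 `bBack`, `kingPr_val`, `B11SectG.hasMaj_zero`).  Nothing in the tree is modified;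
no estimate is proved here.

WHY.  (Ξ-1)–(Ξ-4) read dag-n15-e's two-spacing rung, which is stated for `n ≥ 1` extra scales.  The glued family's index (`SfIdx`: `m`, `kk ≥ 1`, `r`) allows `r = 0`, and the displayed
two-grid row of `N_V^R` (`hD` of (♭-8b)) — hence 234′'s flat inputs — range over ALL indices.  At `r = 0` the «fine» run `Tor (fine (L^0·L^K) M)` is the coarse run up to the value-preserving
relabelling `kingPr L K 0 M` (`⌊x∕L^0⌋ = x`), the couplings agree (`a_{0+K} = a_K`), and the operators on the two runs are the SAME operator transported: every two-grid defect is `0`.  §1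
proves this once for an arbitrary value-preserving relabelling `π : Tor (fine N′ M) → Tor (fine N M)` with `N′ = N` (after `subst`, `π = id` by `ZMod.val_injective`, and `𝔇 = T − T`);
§2 reads it at `π := kingPr L K 0 M`; §3 is (Ξ-4)'s twelve-row package for every `n ≥ 0`.
* §1 `idef_flat_relabel_eq_zero₄` (the four defects vanish for a value-preserving relabelling between equal runs, equal couplings), `hasMaj_flatTwoGrid_relabel` (hence any majorant `≥ 0`);
* §2 `kingPr_zero_val`, `flatTwoGridKernelRows_zero_king` (the four two-grid rows at `n = 0`, any `C ≥ 0`, `δ`, `γ`);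
* §3 ★★★ `flatRowsAll_king'` — (Ξ-4)'s `flatRowsAll_king` WITHOUT the hypothesis `1 ≤ n`.

HONEST FRAMING ∕ LIMITS.  Bookkeeping (transport along a relabelling + (Ξ-4)); King's `A = 0` MODEL statements behind (Ξ-4); MODEL carriers; NOT [Balaban1985BackgroundPropagators] Thm 3.1 as printed;
NE2⁺ NOT PRINTED; N15 of record untouched (DISCHARGED AS CONSUMED, p687738); counts UNMOVED (typed 28∕28 · discharged 8∕27); one finite 𝕋⁴ at fixed ε per index — NOT infinite volume ∕ OS ∕
mass gap ∕ Clay.  Restate-immune (no Theses import).  No `sorry`, `instance`, `notation`; standard axioms.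
-/

noncomputable section

open scoped BigOperators Matrix Kronecker

namespace Summit.QuantumFields.YangMills.BalabanUVNodes.N15.CovLandau

open Literature.MathematicalPhysics.QuantumFieldTheory.Balaban1983to89
open Literature.MathematicalPhysics.QuantumFieldTheory.Balaban1983to89.B5Prop11Plancherel (Tor fine unitVec)
open Literature.MathematicalPhysics.QuantumFieldTheory.Balaban1983to89.B11SectG (BlockNorm HasMaj hasMaj_zero)
open Literature.MathematicalPhysics.QuantumFieldTheory.Balaban1983to89.B6UnitTorusCarrier (unitTorusGeo)
open Literature.MathematicalPhysics.QuantumFieldTheory.Balaban1983to89.T4EtaRateDefect (idef idef_apply)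
open Literature.MathematicalPhysics.QuantumFieldTheory.Balaban1983to89.T4EtaRateCoeffDefect (pull pull_apply)
open Literature.MathematicalPhysics.QuantumFieldTheory.King1986 (aK aK_pos aK_le)
open Literature.MathematicalPhysics.QuantumFieldTheory.King1986.Torus (blockOf tdistT tdistT_nonneg fineOp)
open Summit.QuantumFields.YangMills.BalabanUVNodes.N15.VectorPiece (kingPr kingPrV kingPrV_eq kingPr_val)
open Summit.QuantumFields.YangMills.BalabanUVNodes.N15.MatrixSpecies (liftBlk liftMap)

variable {d : ℕ} (L : ℕ) [NeZero L]

/-! ## §1 A value-preserving relabelling between equal runs has no two-grid defect -/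

section Relabel

omit [NeZero L] in
/-- **THE FOUR FLAT TWO-GRID DEFECTS VANISH FOR A VALUE-PRESERVING RELABELLING BETWEEN EQUAL RUNS** (`N′ = N`, `π` preserves residues, equal couplings): after `subst`, `π = id` and each
defect is `T − T`. [folklore] -/
theorem idef_flat_relabel_eq_zero₄ {N N' : ℕ} [NeZero N] [NeZero N'] (M : Fin (d + 1) → ℕ) [∀ μ, NeZero (M μ)] (h : N' = N) {a a' : ℝ} (ha : a' = a)
    (π : Tor (fine N' M) → Tor (fine N M)) (hπ : ∀ x μ, (π x μ).val = (x μ).val) (ι : Type) [Fintype ι] [DecidableEq ι] :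
    idef (pull (liftMap π ι)) (pull (liftMap π ι)) (Matrix.mulVecLin (cGreen M N' (fun (_ : Fin (d + 1)) (_ : Tor (fine N' M)) => (1 : Matrix ι ι ℝ)) (a' * ((N' : ℕ) : ℝ) ^ (d + 1)))) (Matrix.mulVecLin (cGreen M N (fun (_ : Fin (d + 1)) (_ : Tor (fine N M)) => (1 : Matrix ι ι ℝ)) (a * ((N : ℕ) : ℝ) ^ (d + 1)))) = 0 ∧
    idef (pull (liftMap π ι)) (pull (liftMap (fun b : Tor (fine N' M) × Fin (d + 1) => (π b.1, b.2)) ι)) (Matrix.mulVecLin (cgrad M N' (fun (_ : Fin (d + 1)) (_ : Tor (fine N' M)) => (1 : Matrix ι ι ℝ)) * cGreen M N' (fun (_ : Fin (d + 1)) (_ : Tor (fine N' M)) => (1 : Matrix ι ι ℝ)) (a' * ((N' : ℕ) : ℝ) ^ (d + 1)))) (Matrix.mulVecLin (cgrad M N (fun (_ : Fin (d + 1)) (_ : Tor (fine N M)) => (1 : Matrix ι ι ℝ)) * cGreen M N (fun (_ : Fin (d + 1)) (_ : Tor (fine N M)) => (1 : Matrix ι ι ℝ)) (a * ((N : ℕ)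 : ℝ) ^ (d + 1)))) = 0 ∧
    idef (pull (liftMap (fun b : Tor (fine N' M) × Fin (d + 1) => (π b.1, b.2)) ι)) (pull (liftMap π ι)) (Matrix.mulVecLin (cGreen M N' (fun (_ : Fin (d + 1)) (_ : Tor (fine N' M)) => (1 : Matrix ι ι ℝ)) (a' * ((N' : ℕ) : ℝ) ^ (d + 1)) * (cgrad M N' (fun (_ : Fin (d + 1)) (_ : Tor (fine N' M)) => (1 : Matrix ι ι ℝ)))ᵀ)) (Matrix.mulVecLin (cGreen M N (fun (_ : Fin (d + 1)) (_ : Tor (fine N M)) => (1 : Matrix ι ι ℝ)) (a * ((N : ℕ) : ℝ) ^ (d + 1)) * (cgrad M N (fun (_ : Fin (d + 1)) (_ : Tor (fine N M)) => (1 : Matrix ι ι ℝ)))ᵀ)) = 0 ∧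
    idef (pull (liftMap π ι)) (pull (liftMap (fun b : Tor (fine N' M) × Fin (d + 1) => (π b.1, b.2)) ι)) (Matrix.mulVecLin ((bBack M N' (ι := ι)) * ((cgrad M N' (fun (_ : Fin (d + 1)) (_ : Tor (fine N' M)) => (1 : Matrix ι ι ℝ))) * (cGreen M N' (fun (_ : Fin (d + 1)) (_ : Tor (fine N' M)) => (1 : Matrix ι ι ℝ)) (a' * ((N' : ℕ) : ℝ) ^ (d + 1)))))) (Matrix.mulVecLin ((bBack M N (ι := ι)) * ((cgrad M N (fun (_ : Fin (d + 1)) (_ : Tor (fine N M)) => (1 : Matrix ι ι ℝ))) * (cGreen M N (fun (_ : Fin (d + 1)) (_ : Tor (fine N M)) => (1 : Matrix ι ι ℝ)) (a * ((N : ℕ) : ℝ) ^ (d + 1)))))) = 0 := by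
  subst h
  subst ha
  obtain rfl : π = id := funext fun x => funext fun μ => ZMod.val_injective _ (by rw [hπ]; rfl)
  exact ⟨LinearMap.ext fun f => funext fun p => sub_self _, LinearMap.ext fun f => funext fun p => sub_self _,
    LinearMap.ext fun f => funext fun p => sub_self _, LinearMap.ext fun f => funext fun p => sub_self _⟩

omit [NeZero L] in
/-- Hence, for such a relabelling, the four flat two-grid rows hold with ANY nonnegative majorant `Kf`, in any block geometry label `k`. [folklore] -/
theorem hasMaj_flatTwoGrid_relabel {N N' : ℕ} [NeZero N] [NeZero N'] (M : Fin (d + 1) → ℕ) [∀ μ, NeZero (M μ)] (h : N' = N) {a a' : ℝ} (ha : a' = a)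
    (π : Tor (fine N' M) → Tor (fine N M)) (hπ : ∀ x μ, (π x μ).val = (x μ).val) (k : ℕ) (ι : Type) [Fintype ι] [DecidableEq ι] {Kf : Tor M → Tor M → ℝ} (hKf : ∀ y y', 0 ≤ Kf y y') :
    HasMaj (BlockNorm.ofBlocks (unitTorusGeo L k M) (liftBlk (blockOf N M) ι)) (BlockNorm.ofBlocks (unitTorusGeo L k M) (liftBlk (blockOf N' M) ι)) (idef (pull (liftMap π ι)) (pull (liftMap π ι)) (Matrix.mulVecLin (cGreen M N' (fun (_ : Fin (d + 1)) (_ : Tor (fine N' M)) => (1 : Matrix ι ι ℝ)) (a' * ((N' : ℕ) : ℝ) ^ (d + 1)))) (Matrix.mulVecLin (cGreen M N (fun (_ : Fin (d + 1)) (_ : Tor (fine N M)) => (1 : Matrix ι ι ℝ)) (a * ((N : ℕ) : ℝ) ^ (d + 1))))) Kf ∧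
    HasMaj (BlockNorm.ofBlocks (unitTorusGeo L k M) (liftBlk (blockOf N M) ι)) (BlockNorm.ofBlocks (unitTorusGeo L k M) (liftBlk (fun b : Tor (fine N' M) × Fin (d + 1) => blockOf N' M b.1) ι)) (idef (pull (liftMap π ι)) (pull (liftMap (fun b : Tor (fine N' M) × Fin (d + 1) => (π b.1, b.2)) ι)) (Matrix.mulVecLin (cgrad M N' (fun (_ : Fin (d + 1)) (_ : Tor (fine N' M)) => (1 : Matrix ι ι ℝ)) * cGreen M N' (fun (_ : Fin (d + 1)) (_ : Tor (fine N' M)) => (1 : Matrix ι ι ℝ)) (a' * ((N' : ℕ) : ℝ) ^ (d + 1)))) (Matrix.mulVecLin (cgrad M N (fun (_ : Fin (d + 1)) (_ : Tor (fine N M)) => (1 : Matrix ι ι ℝ)) * cGreen M N (fun (_ : Fin (d + 1)) (_ : Tor (fine N M)) => (1 : Matrix ι ι ℝ)) (a * ((N : ℕ) : ℝ) ^ (d + 1))))) Kf ∧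
    HasMaj (BlockNorm.ofBlocks (unitTorusGeo L k M) (liftBlk (fun b : Tor (fine N M) × Fin (d + 1) => blockOf N M b.1) ι)) (BlockNorm.ofBlocks (unitTorusGeo L k M) (liftBlk (blockOf N' M) ι)) (idef (pull (liftMap (fun b : Tor (fine N' M) × Fin (d + 1) => (π b.1, b.2)) ι)) (pull (liftMap π ι)) (Matrix.mulVecLin (cGreen M N' (fun (_ : Fin (d + 1)) (_ : Tor (fine N' M)) => (1 : Matrix ι ι ℝ)) (a' * ((N' : ℕ) : ℝ) ^ (d + 1)) * (cgrad M N' (fun (_ : Fin (d + 1)) (_ : Tor (fine N' M)) => (1 : Matrix ι ι ℝ)))ᵀ)) (Matrix.mulVecLin (cGreen M N (fun (_ : Fin (d + 1)) (_ : Tor (fine N M)) => (1 : Matrix ι ι ℝ)) (a * ((N : ℕ) : ℝ) ^ (d + 1)) * (cgrad M N (fun (_ : Fin (d + 1)) (_ : Tor (fine N M)) => (1 : Matrix ι ι ℝ)))ᵀ))) Kf ∧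
    HasMaj (BlockNorm.ofBlocks (unitTorusGeo L k M) (liftBlk (blockOf N M) ι)) (BlockNorm.ofBlocks (unitTorusGeo L k M) (liftBlk (fun b : Tor (fine N' M) × Fin (d + 1) => blockOf N' M b.1) ι)) (idef (pull (liftMap π ι)) (pull (liftMap (fun b : Tor (fine N' M) × Fin (d + 1) => (π b.1, b.2)) ι)) (Matrix.mulVecLin ((bBack M N' (ι := ι)) * ((cgrad M N' (fun (_ : Fin (d + 1)) (_ : Tor (fine N' M)) => (1 : Matrix ι ι ℝ))) * (cGreen M N' (fun (_ : Fin (d + 1)) (_ : Tor (fine N' M)) => (1 : Matrix ι ι ℝ)) (a' * ((N' : ℕ) : ℝ) ^ (d + 1)))))) (Matrix.mulVecLin ((bBack M N (ι := ι)) * ((cgrad M N (fun (_ : Fin (d + 1)) (_ : Tor (fine N M)) => (1 : Matrix ι ι ℝ))) * (cGreen M N (fun (_ : Fin (d + 1)) (_ : Tor (fine N M)) => (1 : Matrix ι ι ℝ)) (a * ((N : ℕ) : ℝ) ^ (d + 1))))))) Kf := by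
  obtain ⟨h₁, h₂, h₃, h₄⟩ := idef_flat_relabel_eq_zero₄ (d := d) M h ha π hπ ι
  rw [h₁, h₂, h₃, h₄]
  exact ⟨(hasMaj_zero _ _).mono fun y y' => hKf y y', (hasMaj_zero _ _).mono fun y y' => hKf y y', (hasMaj_zero _ _).mono fun y y' => hKf y y', (hasMaj_zero _ _).mono fun y y' => hKf y y'⟩

end Relabel

/-! ## §2 Zero extra scales: King's pairing `kingPr L K 0 M` is a value-preserving relabelling -/

section Zero

/-- `⌊x∕L^0⌋ = x`: at zero extra scales King's pairing preserves residues. [cite: King1986, p.664 («x′ ∈ B^n(x)», n = 0)] -/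
theorem kingPr_zero_val (K : ℕ) (M : Fin (d + 1) → ℕ) [∀ μ, NeZero (M μ)] (x' : Tor (fine (L ^ 0 * L ^ K) M)) (μ : Fin (d + 1)) :
    (kingPr L K 0 M x' μ).val = (x' μ).val := by
  rw [kingPr_val]
  exact Nat.div_one _

/-- **THE FOUR FLAT TWO-GRID ROWS AT ZERO EXTRA SCALES**, any `C ≥ 0`, `δ`, `γ`: every defect vanishes (§1 at `π := kingPr L K 0 M`, `L^0·L^K = L^K`, `a_{0+K} = a_K`). [folklore] -/
theorem flatTwoGridKernelRows_zero_king (a₀ : ℝ) (K : ℕ) (M : Fin (d + 1) → ℕ) [∀ μ, NeZero (M μ)] (ι : Type) [Fintype ι] [DecidableEq ι] {C : ℝ} (hC : 0 ≤ C) (δ γ : ℝ) :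
    HasMaj (BlockNorm.ofBlocks (unitTorusGeo L K M) (liftBlk (blockOf (L ^ K) M) ι)) (BlockNorm.ofBlocks (unitTorusGeo L K M) (liftBlk (blockOf (L ^ 0 * L ^ K) M) ι)) (idef (pull (liftMap (kingPr L K 0 M) ι)) (pull (liftMap (kingPr L K 0 M) ι)) (Matrix.mulVecLin (cGreen M (L ^ 0 * L ^ K) (fun (_ : Fin (d + 1)) (_ : Tor (fine (L ^ 0 * L ^ K) M)) => (1 : Matrix ι ι ℝ)) (aK a₀ (L : ℝ) (0 + K) * (((L ^ 0 * L ^ K) : ℕ) : ℝ) ^ (d + 1)))) (Matrix.mulVecLin (cGreen M (L ^ K) (fun (_ : Fin (d + 1)) (_ : Tor (fine (L ^ K) M)) => (1 : Matrix ι ι ℝ)) (aK a₀ (L : ℝ) K * (((L ^ K) : ℕ) : ℝ) ^ (d + 1))))) (fun y y' => C * ((L : ℝ) ^ K) ^ (-γ) * Real.exp (-(δ * tdistT M y y'))) ∧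
    HasMaj (BlockNorm.ofBlocks (unitTorusGeo L K M) (liftBlk (blockOf (L ^ K) M) ι)) (BlockNorm.ofBlocks (unitTorusGeo L K M) (liftBlk (fun b : Tor (fine (L ^ 0 * L ^ K) M) × Fin (d + 1) => blockOf (L ^ 0 * L ^ K) M b.1) ι)) (idef (pull (liftMap (kingPr L K 0 M) ι)) (pull (liftMap (kingPrV L K 0 M) ι)) (Matrix.mulVecLin (cgrad M (L ^ 0 * L ^ K) (fun (_ : Fin (d + 1)) (_ : Tor (fine (L ^ 0 * L ^ K) M)) => (1 : Matrix ι ι ℝ)) * cGreen M (L ^ 0 * L ^ K) (fun (_ : Fin (d + 1)) (_ : Tor (fine (L ^ 0 * L ^ K) M)) => (1 : Matrix ι ι ℝ)) (aK a₀ (L : ℝ) (0 + K) * (((L ^ 0 * L ^ K) : ℕ) : ℝ) ^ (d + 1)))) (Matrix.mulVecLin (cgrad M (L ^ K) (fun (_ : Fin (d + 1)) (_ : Tor (fine (L ^ K) M)) => (1 : Matrix ι ι ℝ)) * cGreen M (L ^ K) (fun (_ : Fin (d + 1)) (_ : Tor (fine (L ^ K) M)) => (1 : Matrix ι ι ℝ))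 (aK a₀ (L : ℝ) K * (((L ^ K) : ℕ) : ℝ) ^ (d + 1))))) (fun y y' => C * ((L : ℝ) ^ K) ^ (-γ) * Real.exp (-(δ * tdistT M y y'))) ∧
    HasMaj (BlockNorm.ofBlocks (unitTorusGeo L K M) (liftBlk (fun b : Tor (fine (L ^ K) M) × Fin (d + 1) => blockOf (L ^ K) M b.1) ι)) (BlockNorm.ofBlocks (unitTorusGeo L K M) (liftBlk (blockOf (L ^ 0 * L ^ K) M) ι)) (idef (pull (liftMap (kingPrV L K 0 M) ι)) (pull (liftMap (kingPr L K 0 M) ι)) (Matrix.mulVecLin (cGreen M (L ^ 0 * L ^ K) (fun (_ : Fin (d + 1)) (_ : Tor (fine (L ^ 0 * L ^ K) M)) => (1 : Matrix ι ι ℝ)) (aK a₀ (L : ℝ) (0 + K) * (((L ^ 0 * L ^ K) : ℕ) : ℝ) ^ (d + 1)) * (cgrad M (L ^ 0 * L ^ K) (fun (_ : Fin (d + 1)) (_ : Tor (fine (L ^ 0 * L ^ K) M)) => (1 : Matrix ι ι ℝ)))ᵀ)) (Matrix.mulVecLin (cGreen M (L ^ K) (fun (_ : Fin (d + 1)) (_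 : Tor (fine (L ^ K) M)) => (1 : Matrix ι ι ℝ)) (aK a₀ (L : ℝ) K * (((L ^ K) : ℕ) : ℝ) ^ (d + 1)) * (cgrad M (L ^ K) (fun (_ : Fin (d + 1)) (_ : Tor (fine (L ^ K) M)) => (1 : Matrix ι ι ℝ)))ᵀ))) (fun y y' => C * ((L : ℝ) ^ K) ^ (-γ) * Real.exp (-(δ * tdistT M y y'))) ∧
    HasMaj (BlockNorm.ofBlocks (unitTorusGeo L K M) (liftBlk (blockOf (L ^ K) M) ι)) (BlockNorm.ofBlocks (unitTorusGeo L K M) (liftBlk (fun b : Tor (fine (L ^ 0 * L ^ K) M) × Fin (d + 1) => blockOf (L ^ 0 * L ^ K) M b.1) ι)) (idef (pull (liftMap (kingPr L K 0 M) ι)) (pull (liftMap (kingPrV L K 0 M) ι)) (Matrix.mulVecLin ((bBack M (L ^ 0 * L ^ K) (ι := ι)) * ((cgrad M (L ^ 0 * L ^ K) (fun (_ : Fin (d + 1)) (_ : Tor (fine (L ^ 0 * L ^ K) M)) => (1 : Matrix ι ι ℝ))) * (cGreen M (L ^ 0 * L ^ K) (fun (_ : Fin (d + 1)) (_ : Tor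 (fine (L ^ 0 * L ^ K) M)) => (1 : Matrix ι ι ℝ)) (aK a₀ (L : ℝ) (0 + K) * (((L ^ 0 * L ^ K) : ℕ) : ℝ) ^ (d + 1)))))) (Matrix.mulVecLin ((bBack M (L ^ K) (ι := ι)) * ((cgrad M (L ^ K) (fun (_ : Fin (d + 1)) (_ : Tor (fine (L ^ K) M)) => (1 : Matrix ι ι ℝ))) * (cGreen M (L ^ K) (fun (_ : Fin (d + 1)) (_ : Tor (fine (L ^ K) M)) => (1 : Matrix ι ι ℝ)) (aK a₀ (L : ℝ) K * (((L ^ K) : ℕ) : ℝ) ^ (d + 1))))))) (fun y y' => C * ((L : ℝ) ^ K) ^ (-γ) * Real.exp (-(δ * tdistT M y y'))) := by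
  have hθ : 0 ≤ ((L : ℝ) ^ K) ^ (-γ) := Real.rpow_nonneg (pow_nonneg (Nat.cast_nonneg L) K) _
  exact hasMaj_flatTwoGrid_relabel (d := d) L M (show L ^ 0 * L ^ K = L ^ K by rw [pow_zero, one_mul]) (show aK a₀ (L : ℝ) (0 + K) = aK a₀ (L : ℝ) K by rw [Nat.zero_add])
    (kingPr L K 0 M) (kingPr_zero_val L K M) K ι (fun y y' => mul_nonneg (mul_nonneg hC hθ) (Real.exp_nonneg _))

end Zero

/-! ## §3 The twelve-row package for every `n ≥ 0` -/

section All

/-- ★★★ **(Ξ-4)'s TWELVE FLAT KERNEL ROWS AT ONE CONSTANT BLOCK, FOR EVERY NUMBER `n ≥ 0` OF EXTRA SCALES** (`n ≥ 1`: (Ξ-4) `flatRowsAll_king`; `n = 0`: the one-grid rows are 220's and (Ξ-3)'s at the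
level `0 + K`, the two-grid rows vanish by §2).
[cite: King1986, Thm 3.3 p.655, (3.7)–(3.8) p.656, Prop. 3.8 (3.71) p.664, Prop. 3.9 (3.73) p.665, p.664 («x′ ∈ B^n(x)»), (4.5) p.670; Balaban1983RegularityDecay, Theorem (1.9)–(1.10) p.573; Balaban1985BackgroundPropagators, Thm 3.1 (3.42)–(3.43) pp.397–398, (3.64) p.402 (shapes at `U ≡ 1`)] -/
theorem flatRowsAll_king' (hLodd : Odd L) (hL : 2 ≤ L) {a₀ : ℝ} (ha₀ : 0 < a₀) {γ : ℝ} (hγ0 : 0 < γ) (hγ1 : γ < 1 / 2) :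
    ∃ C δ : ℝ, 0 < C ∧ 0 < δ ∧ ∀ (K : ℕ), 1 ≤ K → ∀ (n : ℕ) (e : ℕ) (M : Fin (d + 1) → ℕ) [∀ μ, NeZero (M μ)], (∀ μ, M μ = 2 * L ^ e) →
      ∀ (ι : Type) [Fintype ι] [DecidableEq ι],
        HasMaj (BlockNorm.ofBlocks (unitTorusGeo L K M) (liftBlk (blockOf (L ^ K) M) ι)) (BlockNorm.ofBlocks (unitTorusGeo L K M) (liftBlk (blockOf (L ^ K) M) ι)) (Matrix.mulVecLin (cGreen M (L ^ K) (fun (_ : Fin (d + 1)) (_ : Tor (fine (L ^ K) M)) => (1 : Matrix ι ι ℝ)) (aK a₀ (L : ℝ) K * (((L ^ K) : ℕ) : ℝ) ^ (d + 1)))) (fun y y' => C * Real.exp (-(δ * tdistT M y y'))) ∧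
        HasMaj (BlockNorm.ofBlocks (unitTorusGeo L K M) (liftBlk (blockOf (L ^ K) M) ι)) (BlockNorm.ofBlocks (unitTorusGeo L K M) (liftBlk (fun b : Tor (fine (L ^ K) M) × Fin (d + 1) => blockOf (L ^ K) M b.1) ι)) (Matrix.mulVecLin (cgrad M (L ^ K) (fun (_ : Fin (d + 1)) (_ : Tor (fine (L ^ K) M)) => (1 : Matrix ι ι ℝ)) * cGreen M (L ^ K) (fun (_ : Fin (d + 1)) (_ : Tor (fine (L ^ K) M)) => (1 : Matrix ι ι ℝ)) (aK a₀ (L : ℝ) K * (((L ^ K) : ℕ) : ℝ) ^ (d + 1)))) (fun y y' => C * Real.exp (-(δ * tdistT M y y'))) ∧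
        HasMaj (BlockNorm.ofBlocks (unitTorusGeo L K M) (liftBlk (fun b : Tor (fine (L ^ K) M) × Fin (d + 1) => blockOf (L ^ K) M b.1) ι)) (BlockNorm.ofBlocks (unitTorusGeo L K M) (liftBlk (blockOf (L ^ K) M) ι)) (Matrix.mulVecLin (cGreen M (L ^ K) (fun (_ : Fin (d + 1)) (_ : Tor (fine (L ^ K) M)) => (1 : Matrix ι ι ℝ)) (aK a₀ (L : ℝ) K * (((L ^ K) : ℕ) : ℝ) ^ (d + 1)) * (cgrad M (L ^ K) (fun (_ : Fin (d + 1)) (_ : Tor (fine (L ^ K) M)) => (1 : Matrix ι ι ℝ)))ᵀ)) (fun y y' => C * Real.exp (-(δ * tdistT M y y'))) ∧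
        HasMaj (BlockNorm.ofBlocks (unitTorusGeo L K M) (liftBlk (blockOf (L ^ K) M) ι)) (BlockNorm.ofBlocks (unitTorusGeo L K M) (liftBlk (fun b : Tor (fine (L ^ K) M) × Fin (d + 1) => blockOf (L ^ K) M b.1) ι)) (Matrix.mulVecLin ((bBack M (L ^ K) (ι := ι)) * ((cgrad M (L ^ K) (fun (_ : Fin (d + 1)) (_ : Tor (fine (L ^ K) M)) => (1 : Matrix ι ι ℝ))) * (cGreen M (L ^ K) (fun (_ : Fin (d + 1)) (_ : Tor (fine (L ^ K) M)) => (1 : Matrix ι ι ℝ)) (aK a₀ (L : ℝ) K * (((L ^ K) : ℕ) : ℝ) ^ (d + 1)))))) (fun y y' => C * Real.exp (-(δ * tdistT M y y'))) ∧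
        HasMaj (BlockNorm.ofBlocks (unitTorusGeo L K M) (liftBlk (blockOf (L ^ n * L ^ K) M) ι)) (BlockNorm.ofBlocks (unitTorusGeo L K M) (liftBlk (blockOf (L ^ n * L ^ K) M) ι)) (Matrix.mulVecLin (cGreen M (L ^ n * L ^ K) (fun (_ : Fin (d + 1)) (_ : Tor (fine (L ^ n * L ^ K) M)) => (1 : Matrix ι ι ℝ)) (aK a₀ (L : ℝ) (n + K) * (((L ^ n * L ^ K) : ℕ) : ℝ) ^ (d + 1)))) (fun y y' => C * Real.exp (-(δ * tdistT M y y'))) ∧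
        HasMaj (BlockNorm.ofBlocks (unitTorusGeo L K M) (liftBlk (blockOf (L ^ n * L ^ K) M) ι)) (BlockNorm.ofBlocks (unitTorusGeo L K M) (liftBlk (fun b : Tor (fine (L ^ n * L ^ K) M) × Fin (d + 1) => blockOf (L ^ n * L ^ K) M b.1) ι)) (Matrix.mulVecLin (cgrad M (L ^ n * L ^ K) (fun (_ : Fin (d + 1)) (_ : Tor (fine (L ^ n * L ^ K) M)) => (1 : Matrix ι ι ℝ)) * cGreen M (L ^ n * L ^ K) (fun (_ : Fin (d + 1)) (_ : Tor (fine (L ^ n * L ^ K) M)) => (1 : Matrix ι ι ℝ)) (aK a₀ (L : ℝ) (n + K) * (((L ^ n * L ^ K) : ℕ) : ℝ) ^ (d + 1)))) (fun y y' => C * Real.exp (-(δ * tdistT M y y'))) ∧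
        HasMaj (BlockNorm.ofBlocks (unitTorusGeo L K M) (liftBlk (fun b : Tor (fine (L ^ n * L ^ K) M) × Fin (d + 1) => blockOf (L ^ n * L ^ K) M b.1) ι)) (BlockNorm.ofBlocks (unitTorusGeo L K M) (liftBlk (blockOf (L ^ n * L ^ K) M) ι)) (Matrix.mulVecLin (cGreen M (L ^ n * L ^ K) (fun (_ : Fin (d + 1)) (_ : Tor (fine (L ^ n * L ^ K) M)) => (1 : Matrix ι ι ℝ)) (aK a₀ (L : ℝ) (n + K) * (((L ^ n * L ^ K) : ℕ) : ℝ) ^ (d + 1)) * (cgrad M (L ^ n * L ^ K) (fun (_ : Fin (d + 1)) (_ : Tor (fine (L ^ n * L ^ K) M)) => (1 : Matrix ι ι ℝ)))ᵀ)) (fun y y' => C * Real.exp (-(δ * tdistT M y y'))) ∧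
        HasMaj (BlockNorm.ofBlocks (unitTorusGeo L K M) (liftBlk (blockOf (L ^ n * L ^ K) M) ι)) (BlockNorm.ofBlocks (unitTorusGeo L K M) (liftBlk (fun b : Tor (fine (L ^ n * L ^ K) M) × Fin (d + 1) => blockOf (L ^ n * L ^ K) M b.1) ι)) (Matrix.mulVecLin ((bBack M (L ^ n * L ^ K) (ι := ι)) * ((cgrad M (L ^ n * L ^ K) (fun (_ : Fin (d + 1)) (_ : Tor (fine (L ^ n * L ^ K) M)) => (1 : Matrix ι ι ℝ))) * (cGreen M (L ^ n * L ^ K) (fun (_ : Fin (d + 1)) (_ : Tor (fine (L ^ n * L ^ K) M)) => (1 : Matrix ι ι ℝ)) (aK a₀ (L : ℝ) (n + K) * (((L ^ n * L ^ K) : ℕ) : ℝ) ^ (d + 1)))))) (fun y y' => C * Real.exp (-(δ * tdistT M y y'))) ∧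
        HasMaj (BlockNorm.ofBlocks (unitTorusGeo L K M) (liftBlk (blockOf (L ^ K) M) ι)) (BlockNorm.ofBlocks (unitTorusGeo L K M) (liftBlk (blockOf (L ^ n * L ^ K) M) ι)) (idef (pull (liftMap (kingPr L K n M) ι)) (pull (liftMap (kingPr L K n M) ι)) (Matrix.mulVecLin (cGreen M (L ^ n * L ^ K) (fun (_ : Fin (d + 1)) (_ : Tor (fine (L ^ n * L ^ K) M)) => (1 : Matrix ι ι ℝ)) (aK a₀ (L : ℝ) (n + K) * (((L ^ n * L ^ K) : ℕ) : ℝ) ^ (d + 1)))) (Matrix.mulVecLin (cGreen M (L ^ K) (fun (_ : Fin (d + 1)) (_ : Tor (fine (L ^ K) M)) => (1 : Matrix ι ι ℝ)) (aK a₀ (L : ℝ) K * (((L ^ K) : ℕ) : ℝ) ^ (d + 1))))) (fun y y' => C * ((L : ℝ) ^ K) ^ (-γ) * Real.exp (-(δ * tdistT M y y'))) ∧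
        HasMaj (BlockNorm.ofBlocks (unitTorusGeo L K M) (liftBlk (blockOf (L ^ K) M) ι)) (BlockNorm.ofBlocks (unitTorusGeo L K M) (liftBlk (fun b : Tor (fine (L ^ n * L ^ K) M) × Fin (d + 1) => blockOf (L ^ n * L ^ K) M b.1) ι)) (idef (pull (liftMap (kingPr L K n M) ι)) (pull (liftMap (kingPrV L K n M) ι)) (Matrix.mulVecLin (cgrad M (L ^ n * L ^ K) (fun (_ : Fin (d + 1)) (_ : Tor (fine (L ^ n * L ^ K) M)) => (1 : Matrix ι ι ℝ)) * cGreen M (L ^ n * L ^ K) (fun (_ : Fin (d + 1)) (_ : Tor (fine (L ^ n * L ^ K) M)) => (1 : Matrix ι ι ℝ)) (aK a₀ (L : ℝ) (n + K) * (((L ^ n * L ^ K) : ℕ) : ℝ) ^ (d + 1)))) (Matrix.mulVecLin (cgrad M (L ^ K) (fun (_ : Fin (d + 1)) (_ : Tor (fine (L ^ K) M)) => (1 : Matrix ι ι ℝ)) * cGreen M (L ^ K) (fun (_ : Fin (d + 1)) (_ : Tor (fine (L ^ K) M)) => (1 : Matrix ι ι ℝ)) (aK a₀ (L : ℝ) K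 * (((L ^ K) : ℕ) : ℝ) ^ (d + 1))))) (fun y y' => C * ((L : ℝ) ^ K) ^ (-γ) * Real.exp (-(δ * tdistT M y y'))) ∧
        HasMaj (BlockNorm.ofBlocks (unitTorusGeo L K M) (liftBlk (fun b : Tor (fine (L ^ K) M) × Fin (d + 1) => blockOf (L ^ K) M b.1) ι)) (BlockNorm.ofBlocks (unitTorusGeo L K M) (liftBlk (blockOf (L ^ n * L ^ K) M) ι)) (idef (pull (liftMap (kingPrV L K n M) ι)) (pull (liftMap (kingPr L K n M) ι)) (Matrix.mulVecLin (cGreen M (L ^ n * L ^ K) (fun (_ : Fin (d + 1)) (_ : Tor (fine (L ^ n * L ^ K) M)) => (1 : Matrix ι ι ℝ)) (aK a₀ (L : ℝ) (n + K) * (((L ^ n * L ^ K) : ℕ) : ℝ) ^ (d + 1)) * (cgrad M (L ^ n * L ^ K) (fun (_ : Fin (d + 1)) (_ : Tor (fine (L ^ n * L ^ K) M)) => (1 : Matrix ι ι ℝ)))ᵀ)) (Matrix.mulVecLin (cGreen M (L ^ K) (fun (_ : Fin (d + 1)) (_ : Tor (fine (L ^ K) M)) => (1 : Matrix ι ι ℝ))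 (aK a₀ (L : ℝ) K * (((L ^ K) : ℕ) : ℝ) ^ (d + 1)) * (cgrad M (L ^ K) (fun (_ : Fin (d + 1)) (_ : Tor (fine (L ^ K) M)) => (1 : Matrix ι ι ℝ)))ᵀ))) (fun y y' => C * ((L : ℝ) ^ K) ^ (-γ) * Real.exp (-(δ * tdistT M y y'))) ∧
        HasMaj (BlockNorm.ofBlocks (unitTorusGeo L K M) (liftBlk (blockOf (L ^ K) M) ι)) (BlockNorm.ofBlocks (unitTorusGeo L K M) (liftBlk (fun b : Tor (fine (L ^ n * L ^ K) M) × Fin (d + 1) => blockOf (L ^ n * L ^ K) M b.1) ι)) (idef (pull (liftMap (kingPr L K n M) ι)) (pull (liftMap (kingPrV L K n M) ι)) (Matrix.mulVecLin ((bBack M (L ^ n * L ^ K) (ι := ι)) * ((cgrad M (L ^ n * L ^ K) (fun (_ : Fin (d + 1)) (_ : Tor (fine (L ^ n * L ^ K) M)) => (1 : Matrix ι ι ℝ))) * (cGreen M (L ^ n * L ^ K) (fun (_ : Fin (d + 1)) (_ : Tor (fine (L ^ n * L ^ K) M)) => (1 : Matrix ι ι ℝ)) (aK a₀ (L : ℝ)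 (n + K) * (((L ^ n * L ^ K) : ℕ) : ℝ) ^ (d + 1)))))) (Matrix.mulVecLin ((bBack M (L ^ K) (ι := ι)) * ((cgrad M (L ^ K) (fun (_ : Fin (d + 1)) (_ : Tor (fine (L ^ K) M)) => (1 : Matrix ι ι ℝ))) * (cGreen M (L ^ K) (fun (_ : Fin (d + 1)) (_ : Tor (fine (L ^ K) M)) => (1 : Matrix ι ι ℝ)) (aK a₀ (L : ℝ) K * (((L ^ K) : ℕ) : ℝ) ^ (d + 1))))))) (fun y y' => C * ((L : ℝ) ^ K) ^ (-γ) * Real.exp (-(δ * tdistT M y y'))) := by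
  obtain ⟨C, δ, hC, hδ, H⟩ := flatRowsAll_king (d := d) L hLodd hL ha₀ hγ0 hγ1
  obtain ⟨C₁, δ₁, hC₁, hδ₁, H₁⟩ := flatKernelRows_king (d := d) L hLodd hL ha₀
  obtain ⟨C₂, δ₂, hC₂, hδ₂, H₂⟩ := flatKernelRow_gradBack_king (d := d) L hLodd hL ha₀
  refine ⟨max C (max C₁ C₂), min δ (min δ₁ δ₂), lt_max_of_lt_left hC, lt_min hδ (lt_min hδ₁ hδ₂), ?_⟩
  intro K hK n e M _ hM ι _ _
  have hCpos : 0 ≤ max C (max C₁ C₂) := hC.le.trans (le_max_left _ _)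
  have hθ : 0 ≤ ((L : ℝ) ^ K) ^ (-γ) := Real.rpow_nonneg (pow_nonneg (Nat.cast_nonneg L) K) _
  have hm1 : ∀ (c δ' : ℝ) (y y' : Tor M), c ≤ max C (max C₁ C₂) → min δ (min δ₁ δ₂) ≤ δ' →
      c * Real.exp (-(δ' * tdistT M y y')) ≤ max C (max C₁ C₂) * Real.exp (-(min δ (min δ₁ δ₂) * tdistT M y y')) :=
    fun c δ' y y' hc hδ' => mul_le_mul hc (Real.exp_le_exp.mpr (by nlinarith [tdistT_nonneg M y y'])) (Real.exp_nonneg _) hCpos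
  have hm2 : ∀ (c δ' : ℝ) (y y' : Tor M), c ≤ max C (max C₁ C₂) → min δ (min δ₁ δ₂) ≤ δ' →
      c * ((L : ℝ) ^ K) ^ (-γ) * Real.exp (-(δ' * tdistT M y y')) ≤ max C (max C₁ C₂) * ((L : ℝ) ^ K) ^ (-γ) * Real.exp (-(min δ (min δ₁ δ₂) * tdistT M y y')) :=
    fun c δ' y y' hc hδ' => mul_le_mul (mul_le_mul_of_nonneg_right hc hθ) (Real.exp_le_exp.mpr (by nlinarith [tdistT_nonneg M y y'])) (Real.exp_nonneg _) (mul_nonneg hCpos hθ)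
  have h0 : C ≤ max C (max C₁ C₂) := le_max_left _ _
  have h1 : C₁ ≤ max C (max C₁ C₂) := (le_max_left _ _).trans (le_max_right _ _)
  have h2 : C₂ ≤ max C (max C₁ C₂) := (le_max_right _ _).trans (le_max_right _ _)
  have e0 : min δ (min δ₁ δ₂) ≤ δ := min_le_left _ _
  have e1 : min δ (min δ₁ δ₂) ≤ δ₁ := (min_le_right _ _).trans (min_le_left _ _)
  have e2 : min δ (min δ₁ δ₂) ≤ δ₂ := (min_le_right _ _).trans (min_le_right _ _)
  rcases Nat.eq_zero_or_pos n with hn0 | hn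
  · -- zero extra scales: one-grid rows at the level `0 + K`, two-grid rows vanish
    subst hn0
    have hKn : 1 ≤ 0 + K := by rw [Nat.zero_add]; exact hK
    have hpow : L ^ 0 * L ^ K = L ^ (0 + K) := (pow_add L 0 K).symm
    obtain ⟨hGc, hDc, hAc⟩ := H₁ K hK (L ^ K) rfl e M hM K ι
    obtain ⟨hGf, hDf, hAf⟩ := H₁ (0 + K) hKn (L ^ 0 * L ^ K) hpow e M hM K ι
    have hBc := H₂ K hK (L ^ K) rfl e M hM K ι
    have hBf := H₂ (0 + K) hKn (L ^ 0 * L ^ K) hpow e M hM K ι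
    obtain ⟨hTG, hTD, hTA, hTB⟩ := flatTwoGridKernelRows_zero_king (d := d) L a₀ K M ι hCpos (min δ (min δ₁ δ₂)) γ
    exact ⟨hGc.mono fun y y' => hm1 C₁ δ₁ y y' h1 e1, hDc.mono fun y y' => hm1 C₁ δ₁ y y' h1 e1, hAc.mono fun y y' => hm1 C₁ δ₁ y y' h1 e1, hBc.mono fun y y' => hm1 C₂ δ₂ y y' h2 e2,
      hGf.mono fun y y' => hm1 C₁ δ₁ y y' h1 e1, hDf.mono fun y y' => hm1 C₁ δ₁ y y' h1 e1, hAf.mono fun y y' => hm1 C₁ δ₁ y y' h1 e1, hBf.mono fun y y' => hm1 C₂ δ₂ y y' h2 e2,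
      hTG, hTD, hTA, hTB⟩
  · obtain ⟨r1, r2, r3, r4, r5, r6, r7, r8, r9, r10, r11, r12⟩ := H K hK n hn e M hM ι
    exact ⟨r1.mono fun y y' => hm1 C δ y y' h0 e0, r2.mono fun y y' => hm1 C δ y y' h0 e0, r3.mono fun y y' => hm1 C δ y y' h0 e0, r4.mono fun y y' => hm1 C δ y y' h0 e0,
      r5.mono fun y y' => hm1 C δ y y' h0 e0, r6.mono fun y y' => hm1 C δ y y' h0 e0, r7.mono fun y y' => hm1 C δ y y' h0 e0, r8.mono fun y y' => hm1 C δ y y' h0 e0,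
      r9.mono fun y y' => hm2 C δ y y' h0 e0, r10.mono fun y y' => hm2 C δ y y' h0 e0, r11.mono fun y y' => hm2 C δ y y' h0 e0, r12.mono fun y y' => hm2 C δ y y' h0 e0⟩

end All

end Summit.QuantumFields.YangMills.BalabanUVNodes.N15.CovLandau

end
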